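import Literature.NumberTheory.Weil1964.AdicCompletionWeilIndexHilbertSymbol
import Literature.NumberTheory.QuadraticForms.HilbertSymbolBilinear
import HarnessLib

/-!
# Scaling the coefficient of Weil's Gauss integral: `g(αx) · γ(1) · ‖α‖^{1/2} = (α, x)_v · γ(α) · g(x)`

[Weil1964] A. Weil, *Sur certains groupes d'opérateurs unitaires*, Acta Math. 111 (1964), Chap. I n° 14 Thm. 2 Cor. 2
(`|g(f)| = |ρ|^{-1/2}`) and Chap. II n° 28 (28) (`γ(b) γ(-ab) = (a, b) γ(1) γ(-a)`), at the finite places `v` of a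
number field `K` (dyadic ones included), combined into the change of Weil's stable Gauss integral
`g(a) = weilGauss ψ μ a` under SCALING OF THE COEFFICIENT:

* `weilIndex_mul_weilIndex_one_eq` — `γ(αx) γ(1) = (α, x)_v γ(α) γ(x)` (the phase);
* `norm_weilGauss_mul_sqrt_eq` — `‖g(αx)‖ · ‖α‖_v^{1/2} = ‖g(x)‖` (the modulus);
* **`weilGauss_mul_eq_hilbertSymbol`** — `g(αx) · γ(1) · ‖α‖_v^{1/2} = (α, x)_v · γ(α) · g(x)`;
* `weilIndex_mul_self_eq` — `γ(α)² = (-1, α)_v γ(1)²`.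

Written for the cell `hodgecm-mathlib` (h413 road, SOCKETS-H413 §3 S6 «G2a»: the cross-line sign of the finite-level
characters of the two `(U(1), U(1))` oscillator representations is a product of four such scalings); THEOREMS ONLY, no
definition, no named fact, no `sorry`.  HC_CM is proved only modulo the 7 printed citations until rung 0 closes.

## References
* [Weil1964] A. Weil, Acta Math. 111 (1964) 143–211: Chap. I n° 14 Thm. 2 Cor. 2 p. 162; Chap. II n° 27 p. 175, n° 28
  (28) p. 177.
* [Omeara1963] O. T. O'Meara, *Introduction to quadratic forms*, §63B (bilinearity of the local Hilbert symbol).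
-/

set_option autoImplicit false

noncomputable section

open MeasureTheory Set NumberField IsDedekindDomain
open scoped NNReal
open Literature.NumberTheory.GaloisRepresentations.IsNonarchimedeanLocalField
open Literature.NumberTheory.Automorphic Literature.NumberTheory.QuadraticForms

namespace Literature.NumberTheory.Weil1964

section Field

variable {F : Type*} [Field F]

/-- `(a, -a)_F = 1`: `a x² - a y² = 1` with `x + y = 1`, `x - y = a⁻¹` (`2 ≠ 0`). [cite: Omeara1963, §63B (definition of the Hilbert symbol) with §57 Prop. 57:10 (1)] -/
theorem hilbertSymbol_self_neg [NeZero (2 : F)] {a : F} (ha : a ≠ 0) : QuadraticForms.hilbertSymbol F a (-a) = 1 := by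
  have h2 : (2 : F) ≠ 0 := two_ne_zero
  rw [QuadraticForms.hilbertSymbol_eq_one_iff]
  refine ⟨(1 + a⁻¹) / 2, (1 - a⁻¹) / 2, ?_⟩
  field_simp
  ring

/-- `(a, b c²)_F = (a, b)_F` for `c ≠ 0` (rescale `y`). [cite: Omeara1963, §63B] -/
theorem hilbertSymbol_mul_sq_right (a b : F) {c : F} (hc : c ≠ 0) :
    QuadraticForms.hilbertSymbol F a (b * c ^ 2) = QuadraticForms.hilbertSymbol F a b := by
  have key : (∃ x y : F, a * x ^ 2 + b * c ^ 2 * y ^ 2 = 1) ↔ ∃ x y : F, a * x ^ 2 + b * y ^ 2 = 1 := by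
    constructor
    · rintro ⟨x, y, h⟩; exact ⟨x, c * y, by linear_combination h⟩
    · rintro ⟨x, y, h⟩; exact ⟨x, y / c, by rw [show b * c ^ 2 * (y / c) ^ 2 = b * y ^ 2 by field_simp]; exact h⟩
  unfold QuadraticForms.hilbertSymbol
  by_cases h : ∃ x y : F, a * x ^ 2 + b * y ^ 2 = 1
  · rw [if_pos (key.2 h), if_pos h]
  · rw [if_neg (fun h' => h (key.1 h')), if_neg h]

end Field

variable (K : Type) [Field K] [NumberField K] (v : HeightOneSpectrum (𝓞 K))
  [MeasurableSpace (v.adicCompletion K)] [BorelSpace (v.adicCompletion K)]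
  (μ : Measure (v.adicCompletion K)) [μ.IsAddHaarMeasure] {ψ : AddChar (v.adicCompletion K) Circle}

/-- **`γ(α)² = (-1, α)_v γ(1)²`** ((28) with `a = -1`, `b = α`). [cite: Weil1964, Chap. II n° 28, (28), p. 177] -/
theorem weilIndex_mul_self_eq (hψ : ψ.IsContinuousNontrivial) {α : v.adicCompletion K} (hα : α ≠ 0) :
    weilIndex ψ μ α * weilIndex ψ μ α =
      (hilbertSymbol (v.adicCompletion K) (-1) α : ℂ) * (weilIndex ψ μ 1 * weilIndex ψ μ 1) := by
  have h := weilIndex_hilbertSymbol_law_adicCompletion K v μ hψ (a := -1) (b := α) (neg_ne_zero.2 one_ne_zero) hα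
  rwa [neg_one_mul, neg_neg, neg_neg] at h

/-- **The phase: `γ(αx) γ(1) = (α, x)_v γ(α) γ(x)`** — (28) twice (`a = -α, b = x` and `a = -1, b = x`) and the
bilinearity of the local Hilbert symbol. [cite: Weil1964, Chap. II n° 28, (28), p. 177] -/
theorem weilIndex_mul_weilIndex_one_eq (hψ : ψ.IsContinuousNontrivial) {α x : v.adicCompletion K} (hα : α ≠ 0)
    (hx : x ≠ 0) :
    weilIndex ψ μ (α * x) * weilIndex ψ μ 1 =
      (hilbertSymbol (v.adicCompletion K) α x : ℂ) * (weilIndex ψ μ α * weilIndex ψ μ x) := by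
  haveI : CharZero (v.adicCompletion K) := charZero_of_injective_algebraMap (algebraMap K _).injective
  have htwo : (2 : v.adicCompletion K) ≠ 0 := two_ne_zero
  -- (28) with `a = -α`, `b = x`: `γ(x) γ(αx) = (-α, x) γ(1) γ(α)`
  have h1 := weilIndex_hilbertSymbol_law_adicCompletion K v μ hψ (a := -α) (b := x) (neg_ne_zero.2 hα) hx
  rw [neg_mul, neg_neg, neg_neg] at h1
  -- (28) with `a = -1`, `b = x`: `γ(x)² = (-1, x) γ(1)²`
  have h2 := weilIndex_mul_self_eq K v μ hψ hx
  -- bilinearity: `(-α, x) = (α, x) (-1, x)`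
  have hsym : (hilbertSymbol (v.adicCompletion K) (-α) x : ℂ) =
      (hilbertSymbol (v.adicCompletion K) α x : ℂ) * hilbertSymbol (v.adicCompletion K) (-1) x := by
    rw [show -α = α * -1 by ring, hilbertSymbol_adicCompletion_mul_left K v hα (neg_ne_zero.2 one_ne_zero) hx,
      Int.cast_mul]
  have hs2 : (hilbertSymbol (v.adicCompletion K) (-1) x : ℂ) * hilbertSymbol (v.adicCompletion K) (-1) x = 1 := by
    rw [← Int.cast_mul]
    rcases hilbertSymbol_eq_one_or_eq_neg_one (-1 : v.adicCompletion K) x with h | h <;> rw [h] <;> norm_num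
  have hγx : weilIndex ψ μ x ≠ 0 := by
    intro h0
    have hn := norm_weilIndex μ hψ hx htwo
    rw [h0, norm_zero] at hn
    exact zero_ne_one hn
  -- `γ(1)² = (-1, x) γ(x)²` (from `h2` and `(-1,x)² = 1`)
  have h2' : weilIndex ψ μ 1 * weilIndex ψ μ 1 =
      (hilbertSymbol (v.adicCompletion K) (-1) x : ℂ) * (weilIndex ψ μ x * weilIndex ψ μ x) := by
    rw [h2, ← mul_assoc, hs2, one_mul]
  -- cancel `γ(x)`
  refine mul_right_cancel₀ hγx ?_
  calc weilIndex ψ μ (α * x) * weilIndex ψ μ 1 * weilIndex ψ μ x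
      = weilIndex ψ μ 1 * (weilIndex ψ μ x * weilIndex ψ μ (α * x)) := by ring
    _ = weilIndex ψ μ 1 * ((hilbertSymbol (v.adicCompletion K) (-α) x : ℂ) *
          (weilIndex ψ μ 1 * weilIndex ψ μ α)) := by rw [h1]
    _ = (hilbertSymbol (v.adicCompletion K) α x : ℂ) * weilIndex ψ μ α *
          ((hilbertSymbol (v.adicCompletion K) (-1) x : ℂ) * (weilIndex ψ μ 1 * weilIndex ψ μ 1)) := by
          rw [hsym]; ring
    _ = (hilbertSymbol (v.adicCompletion K) α x : ℂ) * weilIndex ψ μ α *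
          (((hilbertSymbol (v.adicCompletion K) (-1) x : ℂ) * hilbertSymbol (v.adicCompletion K) (-1) x) *
            (weilIndex ψ μ x * weilIndex ψ μ x)) := by rw [h2']; ring
    _ = (hilbertSymbol (v.adicCompletion K) α x : ℂ) * (weilIndex ψ μ α * weilIndex ψ μ x) * weilIndex ψ μ x := by
          rw [hs2]; ring

/-- **The modulus: `‖g(αx)‖ · ‖α‖_v^{1/2} = ‖g(x)‖`** (`|g(f)|² = selfDualConst · ‖2a‖⁻¹`, Weil's `|g(f)| = |ρ|^{-1/2}`).
[cite: Weil1964, Chap. I n° 14 Thm. 2 Cor. 2, p. 162; Chap. II n° 27, p. 175] -/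
theorem norm_weilGauss_mul_sqrt_eq (hψ : ψ.IsContinuousNontrivial) {α x : v.adicCompletion K} (hα : α ≠ 0)
    (hx : x ≠ 0) :
    ‖weilGauss ψ μ (α * x)‖ * Real.sqrt (normAbs (v.adicCompletion K) α) = ‖weilGauss ψ μ x‖ := by
  haveI : CharZero (v.adicCompletion K) := charZero_of_injective_algebraMap (algebraMap K _).injective
  have htwo : (2 : v.adicCompletion K) ≠ 0 := two_ne_zero
  obtain ⟨d, hd⟩ := hψ.exists_hasConductorExp
  obtain ⟨vx, hvx⟩ := exists_normAbs_eq_inv_zpow hx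
  obtain ⟨vαx, hvαx⟩ := exists_normAbs_eq_inv_zpow (mul_ne_zero hα hx)
  obtain ⟨v₂, hv₂⟩ := exists_normAbs_eq_inv_zpow htwo
  have h1 := norm_sq_weilGauss_eq_selfDualConst_mul μ hd hvαx hv₂
  have h2 := norm_sq_weilGauss_eq_selfDualConst_mul μ hd hvx hv₂
  -- `‖g(αx)‖² ‖α‖ = ‖g(x)‖²`
  have hα' : (normAbs (v.adicCompletion K) α : ℝ) ≠ 0 := by
    exact_mod_cast ((map_ne_zero (normAbs (v.adicCompletion K))).2 hα)
  have hsq : (‖weilGauss ψ μ (α * x)‖ * Real.sqrt (normAbs (v.adicCompletion K) α)) ^ 2 = ‖weilGauss ψ μ x‖ ^ 2 := by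
    rw [mul_pow, Real.sq_sqrt (NNReal.coe_nonneg _), h1, h2]
    have e : normAbs (v.adicCompletion K) (2 * (α * x)) = normAbs (v.adicCompletion K) α *
        normAbs (v.adicCompletion K) (2 * x) := by rw [map_mul, map_mul, map_mul]; ring
    rw [e, mul_inv, NNReal.coe_mul, NNReal.coe_inv]
    field_simp
  have hn1 : 0 ≤ ‖weilGauss ψ μ (α * x)‖ * Real.sqrt (normAbs (v.adicCompletion K) α) :=
    mul_nonneg (norm_nonneg _) (Real.sqrt_nonneg _)
  nlinarith [hsq, hn1, norm_nonneg (weilGauss ψ μ x), sq_nonneg (‖weilGauss ψ μ (α * x)‖ *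
    Real.sqrt (normAbs (v.adicCompletion K) α) - ‖weilGauss ψ μ x‖),
    sq_nonneg (‖weilGauss ψ μ (α * x)‖ * Real.sqrt (normAbs (v.adicCompletion K) α) + ‖weilGauss ψ μ x‖)]

/-- **SCALING THE COEFFICIENT OF WEIL'S GAUSS INTEGRAL**: `g(αx) · γ(1) · ‖α‖_v^{1/2} = (α, x)_v · γ(α) · g(x)` for
`α, x ∈ K_vˣ` — phase by (28) (`weilIndex_mul_weilIndex_one_eq`), modulus by `|g(f)| = |ρ|^{-1/2}`
(`norm_weilGauss_mul_sqrt_eq`). [cite: Weil1964, Chap. II n° 28, (28), p. 177; Chap. I n° 14 Thm. 2 Cor. 2, p. 162] -/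
theorem weilGauss_mul_eq_hilbertSymbol (hψ : ψ.IsContinuousNontrivial) {α x : v.adicCompletion K} (hα : α ≠ 0)
    (hx : x ≠ 0) :
    weilGauss ψ μ (α * x) * weilIndex ψ μ 1 * (Real.sqrt (normAbs (v.adicCompletion K) α) : ℂ) =
      (hilbertSymbol (v.adicCompletion K) α x : ℂ) * weilIndex ψ μ α * weilGauss ψ μ x := by
  haveI : CharZero (v.adicCompletion K) := charZero_of_injective_algebraMap (algebraMap K _).injective
  have htwo : (2 : v.adicCompletion K) ≠ 0 := two_ne_zero
  rw [weilGauss_eq_weilIndex_mul_norm μ hψ (mul_ne_zero hα hx) htwo, weilGauss_eq_weilIndex_mul_norm μ hψ hx htwo,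
    ← norm_weilGauss_mul_sqrt_eq K v μ hψ hα hx, Complex.ofReal_mul]
  have hph := weilIndex_mul_weilIndex_one_eq K v μ hψ hα hx
  calc weilIndex ψ μ (α * x) * ↑‖weilGauss ψ μ (α * x)‖ * weilIndex ψ μ 1 * ↑(Real.sqrt (normAbs (v.adicCompletion K) α))
      = (weilIndex ψ μ (α * x) * weilIndex ψ μ 1) *
          (↑‖weilGauss ψ μ (α * x)‖ * ↑(Real.sqrt (normAbs (v.adicCompletion K) α))) := by ring
    _ = (hilbertSymbol (v.adicCompletion K) α x : ℂ) * (weilIndex ψ μ α * weilIndex ψ μ x) *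
          (↑‖weilGauss ψ μ (α * x)‖ * ↑(Real.sqrt (normAbs (v.adicCompletion K) α))) := by rw [hph]
    _ = (hilbertSymbol (v.adicCompletion K) α x : ℂ) * weilIndex ψ μ α *
          (weilIndex ψ μ x * (↑‖weilGauss ψ μ (α * x)‖ * ↑(Real.sqrt (normAbs (v.adicCompletion K) α)))) := by ring

end Literature.NumberTheory.Weil1964

end
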